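import Summits.HodgeConjecture.HodgeConjecture.Theses.CurveNetMordellWeil
import Literature.AlgebraicGeometry.HodgeTheory.GysinFormalismPushforward
import Literature.AlgebraicGeometry.Motives.FiberNetExistence
import Literature.AlgebraicGeometry.Motives.CurveNetExistence
import Summits.HodgeConjecture.HodgeConjecture.Theorems.CurveNetMordellWeilGysinPreservesAlgebraic
import Summits.HodgeConjecture.HodgeConjecture.Theorems.CurveNetMordellWeilComplexOrientationExists
import Summits.HodgeConjecture.HodgeConjecture.Theorems.CurveNetMordellWeilCurveNetExistsTransfer
import Literature.AlgebraicGeometry.HodgeTheory.ComplexConjugationHolds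
import Literature.AlgebraicGeometry.HodgeTheory.SaitoGrFDeRhamCurveNet

/-!
# Route CurveNetMordellWeil — `NetVerticality` at level `q` IS the middle-degree Hodge conjecture at level `q`
(evidence for item stmt-HodgeConjecture-2782 `VerticalSupportMiddle`; `--supports` it; lead prover of line
`tangential-carriers-period-syzygies`, 2026-08-16)

`C⁺ = NetVerticality` (every rational `(q,q)`-class on the total space `X̃` of a curve net over `ℙ^{2q-1}` is supported
on the preimage of a hypersurface) is the statement every line for the crux `VerticalSupportMiddle` has to prove
(`CurveNetMordellWeilVerticalSupportMiddleLever`: the crux implies it, and the lever of line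
`tangential-carriers-period-syzygies` is equivalent to it). This file pins down what it is, level by level (two small
lemmas of that file, `projectiveSpace_union_ne_univ` and `curveNet_image_proj_ne_univ`, are re-proved here as `private`
copies so that this file does not import it):

* `hodge_middle_of_netVerticality` — granted Deligne descent (route item `DeligneDescent`, stmt-HodgeConjecture-2786,
  a printed theorem) and the Hodge conjecture in every codimension `d < q` (the route's induction hypothesis),
  `NetVerticality` at level `q` implies the Hodge conjecture in codimension `q` for EVERY smooth projective `2q`-fold:
  blow up to a curve net (named fact `nonempty_curveNet`, hypothesis — its discharge from the tree's
  `nonempty_curveNet_of_isAlgClosed` is claimed by a literature seat), make the pulled-back class vertical, descend it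
  to Hodge classes of codimension `< q` (descent), use the induction hypothesis and `GysinPreservesAlgebraic` (PROVED),
  push down by `σ_*` (`span_hodgeClasses_le_map_complexGysin_blowDown`, PROVED; Hodge models by
  `nonempty_hodgeModel_holds`, PROVED) — verbatim the middle branch of the route's deciding theorem `closes`.
* `netVerticality_of_hodge_middle` — conversely the Hodge conjecture in codimension `q` on `2q`-folds gives
  `NetVerticality` at level `q` outright (algebraic classes are vertical: `curveNet_image_proj_ne_univ`).
* `netVerticality_iff_hodge_middle` — hence, at each level `q ≥ 2` and under descent + the induction hypothesis,
  `NetVerticality_q ↔ HC^q` on all smooth projective `2q`-folds.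

So `C⁺` is not a crux OF a route to the middle-degree Hodge conjecture: it is that conjecture (at the given level,
modulo the lower levels). A line for stmt-HodgeConjecture-2782 needs an engine that proves middle-degree HC for
curve-fibred `2q`-folds; nothing weaker closes it.
-/

noncomputable section

-- `Summit.HodgeConjecture.HodgeConjecture.Theorems` is the mandated namespace (single-problem summit: Problem =
-- Summit), which `linter.dupNamespace` flags; off tree-wide in the lakefile, restated for stand-alone elaboration.
set_option linter.dupNamespace false

open CategoryTheory AlgebraicGeometry
open Literature.AlgebraicGeometry Literature.AlgebraicGeometry.Motives Literature.AlgebraicGeometry.HodgeTheory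
open Summit.HodgeConjecture.HodgeConjecture.Theses.CurveNetMordellWeil (DeligneDescent)

namespace Summit.HodgeConjecture.HodgeConjecture.Theorems

/-- Two proper Zariski-closed subsets of the irreducible `ℙᵐ_ℂ` do not cover it (private copy of the lever file's lemma). -/
private theorem projectiveSpace_union_ne_univ' (m : ℕ) {T₁ T₂ : Set (projectiveSpace m ℂ).left} (h₁ : IsClosed T₁)
    (h₂ : IsClosed T₂) (h₁' : T₁ ≠ Set.univ) (h₂' : T₂ ≠ Set.univ) : T₁ ∪ T₂ ≠ Set.univ := by
  haveI : IsIntegral (projectiveSpace m ℂ).left :=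
    IsSmoothProjective.isIntegral_holds (isSmoothProjective_projectiveSpace_holds ℂ m)
  intro h
  rcases (isPreirreducible_iff_isClosed_union_isClosed.mp
      (PreirreducibleSpace.isPreirreducible_univ (X := ↥(projectiveSpace m ℂ).left)) T₁ T₂ h₁ h₂ h.symm.le)
    with hle | hle
  · exact h₁' (Set.eq_univ_of_univ_subset hle)
  · exact h₂' (Set.eq_univ_of_univ_subset hle)

/-- The image under `π` of a closed subset of codimension `≥ q` of the total space of a curve net (`m + 1 = 2q`,
`q ≥ 2`) is a proper closed subset of `ℙᵐ` (private copy of the lever file's lemma: `π` is closed, images of points of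
codimension `≥ q` have codimension `≥ q - 1 ≥ 1`, the generic point has codimension `0`). -/
private theorem curveNet_image_proj_ne_univ' {m : ℕ} {X : SchemeOver ℂ} (N : CurveNet m X) {q : ℕ} (hq : 2 ≤ q)
    (hm : m + 1 = 2 * q) {Z : Set N.total.left} (hZ : IsClosed Z) (hcoh : ∀ z ∈ Z, (q : ℕ∞) ≤ Order.coheight z) :
    IsClosed (N.proj.left.base '' Z) ∧ N.proj.left.base '' Z ≠ Set.univ := by
  have hcl : IsClosedMap N.proj.left.base := by
    haveI := N.isProper_proj
    exact N.proj.left.isClosedMap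
  refine ⟨hcl _ hZ, fun h => ?_⟩
  haveI : IsIntegral (projectiveSpace m ℂ).left :=
    IsSmoothProjective.isIntegral_holds (isSmoothProjective_projectiveSpace_holds ℂ m)
  have hη : genericPoint (projectiveSpace m ℂ).left ∈ N.proj.left.base '' Z := h ▸ Set.mem_univ _
  have h1 : ((1 : ℕ) : ℕ∞) ≤ Order.coheight (genericPoint (projectiveSpace m ℂ).left) :=
    le_coheight_of_mem_image N.isSmoothProjective_total (isSmoothProjective_projectiveSpace_holds ℂ m) N.proj hcl
      hcoh (by omega) hη
  have h0 : Order.coheight (genericPoint (projectiveSpace m ℂ).left) = 0 :=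
    Order.coheight_eq_zero.2 fun y _ ↦ Scheme.le_iff_specializes.2 (genericPoint_specializes y)
  rw [h0] at h1
  exact absurd h1 (by norm_num)

/-- **`NetVerticality` at level `q` + descent + HC below `q` ⟹ HC in codimension `q` on every smooth projective
`2q`-fold** (the middle branch of the route's `closes`, with the crux replaced by `C⁺` on honest nets): for `X` smooth
projective of dimension `m + 1 = 2q`, take a curve net `N` on `X` (`nonempty_curveNet`, hypothesis); every rational
`(q,q)`-class on `X̃ = N.total` is supported on `π⁻¹V(F)`, `F ≠ 0`, a proper closed subset (`π` onto, `V(F) ≠ ℙᵐ`), so by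
`DeligneDescent` it is a sum of Gysin images of rational `(d,d)`-classes, `d < q`, from smooth projective `W`, which
are algebraic by hypothesis, and Gysin images of algebraic classes are algebraic (`GysinPreservesAlgebraic`, proved);
finally the Hodge classes of `X` are `σ_*` of those of `X̃` (`span_hodgeClasses_le_map_complexGysin_blowDown`) and `σ_*`
preserves algebraic classes. -/
theorem hodge_middle_of_netVerticality (hN : nonempty_curveNet) (hDesc : DeligneDescent) {q : ℕ} (hq : 2 ≤ q)
    (ih : ∀ d : ℕ, d < q → ∀ ⦃n : ℕ⦄ ⦃W : SchemeOver ℂ⦄, IsSmoothProjective n W →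
      Submodule.span ℂ {b : complexBetti W (2 * d) | IsRationalClass b ∧ IsOfHodgeType n W (2 * d) d d b} ≤
        algebraicClasses W d)
    (hNV : ∀ ⦃m : ℕ⦄ ⦃X : SchemeOver ℂ⦄ (N : CurveNet m X), m + 1 = 2 * q →
      ∀ c : complexBetti N.total (2 * q), IsRationalClass c → IsOfHodgeType (m + 1) N.total (2 * q) q q c →
        ∃ F : MvPolynomial (Fin (m + 1)) ℂ, F ≠ 0 ∧
          c ∈ classesSupportedOn N.total (N.proj.left.base ⁻¹' projHypersurface m F) (2 * q))
    ⦃m : ℕ⦄ ⦃X : SchemeOver ℂ⦄ (hm : m + 1 = 2 * q) (hX : IsSmoothProjective (m + 1) X) :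
    Submodule.span ℂ {c : complexBetti X (2 * q) | IsRationalClass c ∧ IsOfHodgeType (m + 1) X (2 * q) q q c} ≤
      algebraicClasses X q := by
  obtain ⟨μ, hμ⟩ := complexOrientationExists_proof
  obtain ⟨N⟩ := hN hX (by omega)
  obtain ⟨B⟩ := (nonempty_hodgeModel_holds (n := m + 1) (X := N.total)).nonempty N.isSmoothProjective_total
  have hGys := curveNetMordellWeil_gysinPreservesAlgebraic_proof
  -- every rational `(q,q)`-class on the total space is algebraic
  have step : Submodule.span ℂ {c : complexBetti N.total (2 * q) |
      IsRationalClass c ∧ IsOfHodgeType (m + 1) N.total (2 * q) q q c} ≤ algebraicClasses N.total q := by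
    refine Submodule.span_le.2 ?_
    rintro c ⟨hc, hh⟩
    obtain ⟨F, hF, hcF⟩ := hNV N hm c hc hh
    have hY : IsClosed (N.proj.left.base ⁻¹' projHypersurface m F) := isClosed_preimage_projHypersurface N F
    have hYne : N.proj.left.base ⁻¹' projHypersurface m F ≠ Set.univ := by
      intro hU
      apply projHypersurface_ne_univ m hF
      refine Set.eq_univ_of_forall fun t => ?_
      obtain ⟨x, rfl⟩ := N.surjective_proj t
      have hx : x ∈ N.proj.left.base ⁻¹' projHypersurface m F := hU ▸ Set.mem_univ x
      exact hx
    have hmem := hDesc μ hμ N.isSmoothProjective_total _ hY hYne c hc hh (mem_classesSupportedOn_iff.1 hcF)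
    have aux : ∀ S : Submodule ℂ (complexBetti N.total (2 * q)), c ∈ S → S ≤ algebraicClasses N.total q →
        c ∈ algebraicClasses N.total q := fun S h₁ h₂ => h₂ h₁
    refine aux _ hmem ?_
    refine iSup_le fun d => iSup_le fun e => iSup_le fun hde => iSup_le fun he =>
      iSup_le fun W => iSup_le fun m' => iSup_le fun hm' => iSup_le fun hW => iSup_le fun g => ?_
    subst hde
    exact (Submodule.map_mono (ih d (by omega) hW)).trans (hGys μ hμ hW N.isSmoothProjective_total g hm')
  -- push down to `X` along the blow-down `σ` (Gysin with `e = 0`)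
  exact (span_hodgeClasses_le_map_complexGysin_blowDown hμ hX N B q).trans
    ((Submodule.map_mono step).trans (hGys μ hμ N.isSmoothProjective_total hX N.blowDown
      (show m + 1 + 0 = m + 1 by omega)))

/-- **HC in codimension `q` on `2q`-folds ⟹ `NetVerticality` at level `q`**: an algebraic class on the total space of a
curve net — one supported on a closed `Z` of codimension `≥ q` — dies off `π⁻¹(π Z)`, and `π Z ⊊ ℙᵐ` is a proper closed
subset for `q ≥ 2` (`curveNet_image_proj_ne_univ'`), hence lies on a hypersurface `V(F)`, `F ≠ 0`; finite sums stay
vertical because finite unions of proper closed subsets of `ℙᵐ` are proper (`projectiveSpace_union_ne_univ'`). -/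
theorem netVerticality_of_hodge_middle {q : ℕ} (hq : 2 ≤ q)
    (hHC : ∀ ⦃m : ℕ⦄ ⦃X : SchemeOver ℂ⦄, m + 1 = 2 * q → IsSmoothProjective (m + 1) X →
      Submodule.span ℂ {c : complexBetti X (2 * q) | IsRationalClass c ∧ IsOfHodgeType (m + 1) X (2 * q) q q c} ≤
        algebraicClasses X q)
    ⦃m : ℕ⦄ ⦃X : SchemeOver ℂ⦄ (N : CurveNet m X) (hm : m + 1 = 2 * q) (c : complexBetti N.total (2 * q))
    (hc : IsRationalClass c) (hh : IsOfHodgeType (m + 1) N.total (2 * q) q q c) :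
    ∃ F : MvPolynomial (Fin (m + 1)) ℂ, F ≠ 0 ∧
      c ∈ classesSupportedOn N.total (N.proj.left.base ⁻¹' projHypersurface m F) (2 * q) := by
  -- the submodule of classes vertical over SOME proper closed subset of the base
  let S : Submodule ℂ (complexBetti N.total (2 * q)) :=
    { carrier := {x | ∃ T : Set (projectiveSpace m ℂ).left, IsClosed T ∧ T ≠ Set.univ ∧
          x ∈ classesSupportedOn N.total (N.proj.left.base ⁻¹' T) (2 * q)}
      zero_mem' := by
        haveI := N.nonempty_base
        exact ⟨∅, isClosed_empty, Set.empty_ne_univ, Submodule.zero_mem _⟩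
      add_mem' := by
        rintro a b ⟨T₁, hT₁, hT₁', ha⟩ ⟨T₂, hT₂, hT₂', hb⟩
        refine ⟨T₁ ∪ T₂, hT₁.union hT₂, projectiveSpace_union_ne_univ' m hT₁ hT₂ hT₁' hT₂', ?_⟩
        exact Submodule.add_mem _
          (classesSupportedOn_mono (Set.preimage_mono Set.subset_union_left) _ ha)
          (classesSupportedOn_mono (Set.preimage_mono Set.subset_union_right) _ hb)
      smul_mem' := by
        rintro t a ⟨T, hT, hT', ha⟩
        exact ⟨T, hT, hT', Submodule.smul_mem _ t ha⟩ }
  have halg : algebraicClasses N.total q ≤ S := by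
    refine iSup_le fun Z => iSup_le fun hZ => iSup_le fun hcoh => ?_
    intro x hx
    obtain ⟨hcl, hne⟩ := curveNet_image_proj_ne_univ' N hq hm hZ hcoh
    exact ⟨N.proj.left.base '' Z, hcl, hne, classesSupportedOn_mono (Set.subset_preimage_image _ Z) _ hx⟩
  have hcS : c ∈ S := halg (hHC hm N.isSmoothProjective_total (Submodule.subset_span ⟨hc, hh⟩))
  obtain ⟨T, hT, hTne, hcT⟩ := hcS
  obtain ⟨F, e, -, -, hF0, hsub⟩ := exists_form_of_isClosed_of_ne_univ m hT hTne
  exact ⟨F, hF0, classesSupportedOn_mono (Set.preimage_mono hsub) _ hcT⟩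

/-- **`C⁺` at level `q` is the middle-degree Hodge conjecture at level `q`.** Under the existence of curve nets
(`nonempty_curveNet`, proved in the tree as `nonempty_curveNet_of_isAlgClosed`, discharge pending), Deligne descent (route
item, printed theorem) and the Hodge conjecture in all codimensions `d < q` (the route's induction hypothesis), for every
`q ≥ 2`: `NetVerticality` at level `q` (every rational `(q,q)`-class on the total space of a curve net over `ℙ^{2q-1}`
is supported on the preimage of a hypersurface) holds iff the Hodge conjecture holds in codimension `q` for every smooth
projective variety of dimension `2q`. -/
theorem netVerticality_iff_hodge_middle :
    nonempty_curveNet → DeligneDescent → ∀ ⦃q : ℕ⦄, 2 ≤ q →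
      (∀ d : ℕ, d < q → ∀ ⦃n : ℕ⦄ ⦃W : SchemeOver ℂ⦄, IsSmoothProjective n W →
        Submodule.span ℂ {b : complexBetti W (2 * d) | IsRationalClass b ∧ IsOfHodgeType n W (2 * d) d d b} ≤
          algebraicClasses W d) →
      ((∀ ⦃m : ℕ⦄ ⦃X : SchemeOver ℂ⦄ (N : CurveNet m X), m + 1 = 2 * q →
          ∀ c : complexBetti N.total (2 * q), IsRationalClass c → IsOfHodgeType (m + 1) N.total (2 * q) q q c →
            ∃ F : MvPolynomial (Fin (m + 1)) ℂ, F ≠ 0 ∧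
              c ∈ classesSupportedOn N.total (N.proj.left.base ⁻¹' projHypersurface m F) (2 * q)) ↔
        ∀ ⦃m : ℕ⦄ ⦃X : SchemeOver ℂ⦄, m + 1 = 2 * q → IsSmoothProjective (m + 1) X →
          Submodule.span ℂ {c : complexBetti X (2 * q) | IsRationalClass c ∧ IsOfHodgeType (m + 1) X (2 * q) q q c} ≤
            algebraicClasses X q) := by
  intro hN hDesc q hq ih
  exact ⟨fun hNV m X hm hX => hodge_middle_of_netVerticality hN hDesc hq ih hNV hm hX,
    fun hHC m X N hm c hc hh => netVerticality_of_hodge_middle hq hHC N hm c hc hh⟩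

end Summit.HodgeConjecture.HodgeConjecture.Theorems

end
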